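import Summits.BirchSwinnertonDyer.BirchSwinnertonDyer.Theorems.AlignedTransportAtTwoMainConjectureOfRankZeroBSDAtTwoHalfDescentBaseIndexEuler
import Summits.BirchSwinnertonDyer.BirchSwinnertonDyer.Theorems.AlignedTransportAtTwoMainConjectureOfRankZeroBSDAtTwoHalfDescentBaseIndexTamagawa
import Literature.NumberTheory.DiophantineGeometry.LocalReductionFiniteBadPlacesProofs
import Mathlib.RingTheory.Nakayama
import HarnessLib

/-!
# Route `AlignedTransportAtTwo`, crux C2 `MainConjectureOfRankZeroBSDAtTwo` (stmt-BirchSwinnertonDyer-22298):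
# THE BASE TERM CARRIES `p^μ`, XIII — NO FINITE SUBMODULE ON THE SEED CELL, BY A NUMERICAL SQUEEZE: for every seed `W` (good ORDINARY at `2`, no rational `2`-torsion,
# `Sel_{2^∞}(W/ℚ)` finite of order `2^s`) and every dual datum, `X(W/ℚ_∞)` has NO non-zero finite `Λ`-submodule (Greenberg's Prop. 4.14/4.15 at `p = 2` on the rank-`0` good-ordinary
# locus — in the tree a NAMED FACT with «no `_holds` expected soon»), `#Sel_{2^∞}(W/ℚ)·#ker g_0 = 2^{𝔢}` and `#ker g_0 = 2^{ord₂ Tam + 2·ord₂ #W̃(𝔽₂)}` EXACTLY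

HONEST FRAMING (cell `bsd-f1-sign2`, WIDTH-5 attached prover seat `bsd-line-att-p5` gen 61 on line `birth` of the lead `bsd-line-att-p2`;
`--supports` stmt-BirchSwinnertonDyer-22298, closes nothing; BSD is NOT proved by any of this; the crux C2, its verdict «blocked-on
`Rank1Residual.GreenbergMuConjectureIrreducible`» and every registered stub (P / T / Kμ / LimDoor / MuIneqʳ / PFμ⁺) are untouched). THEOREMS ONLY — no `def`,
no instance, no named fact, no `sorry`; print-free. THE SQUEEZE: by `…BaseIndexEuler` (Greenberg's Thm. 4.1 in the kernel × gen 60's base count), on the cell `W(ℚ)[p] = 0`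
`#Sel_{p^∞}(W/ℚ)·#ker g_0 = p^{v + 2e + s}·#(F/TF)` for the largest finite submodule `F` of `X`; by `…BaseIndexTamagawa` (Greenberg's Lemmas 3.3/3.4 in the kernel)
`#ker g_0 ≤ #W̃(𝔽_p)·p^{ord_p #W̃(𝔽_p)}·p^{v}`. When `#W̃(𝔽_p)` is a PURE power of `p` (always at an ordinary `2`: `#W̃(𝔽₂) ∈ {2, 4}`; at odd `p` exactly when `a_p = 1`, `#W̃(𝔽_p) = p`)
and `#Sel_{p^∞}(W/ℚ) = p^s`, the two displays force `#(F/TF) = 1`, i.e. `F = TF`, and Nakayama (`T ∈ 𝔪_Λ`, `F` finitely generated) gives `F = 0`. No Cassels–Poitou–Tate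
surjectivity, no twisted Selmer groups — the printed route of Prop. 4.14 is bypassed on this locus. As by-products the base control kernel and the base term are EXACT.

* §1 ★ `submodule_eq_bot_of_natCard_quotient_X_smul_top_eq_one`: a finite `Λ`-submodule `F` with `#(F/TF) = 1` is `0` (Nakayama in the local ring `Λ`);
  ★ `exists_finset_places`: a finite set of places of `ℚ` containing the place of `p` and the bad places (tree `finite_badPlaces_holds`).
* §2 (`ℚ`, good ordinary `p`, `W(ℚ)[p] = 0`, `#W̃(𝔽_p) = p^k`, `#Sel_{p^∞}(W/ℚ) = p^s`) ★★★ `natCard_quotient_eq_one_of_pure`: `#(F/TF) = 1` for every finite `F ≤ X` with `X/F` free of finite submodules,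
  ★★★ `forall_finite_submodule_eq_bot_of_pure`: **every finite `Λ`-submodule of `X(W/ℚ_∞)` is `0`**, ★★ `natCard_selmer_mul_kerG_zero_eq_pow_of_pure` (`#Sel·#ker g_0 = p^{v+2k+s}`),
  ★★ `natCard_kerG_zero_eq_pow_of_pure` (**`#ker g_0 = p^{v + 2k}`**: the local kernels are saturated), ★★ `natCard_selmerInvariants_zero_eq_pow_of_pure` (`#Sel_{p^∞}(W/ℚ_∞)^Γ = p^{v+2k+s}`).
* §3 (`p = 2`, THE SEED CELL of C2: good ordinary at `2`, C2's binder `∀ x, ¬ HasRationalTwoTorsionX W x`, `#Sel_{2^∞}(W/ℚ) = 2^s`) ★★★ `forall_finite_submodule_eq_bot_seed`: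
  **`X(W/ℚ_∞)` has no non-zero finite `Λ`-submodule, for every seed and every dual datum** (the `p = 2`, rank-`0`, good-ordinary instance of the named fact
  `Greenberg1999.prop414_noFiniteSubmodule_of_not_dvd_torsionOrder`, here a THEOREM); ★★ `natCard_kerG_zero_eq_seed` (**`#ker g_0 = 2^{ord₂ Tam(W) + 2·ord₂ #W̃(𝔽₂)}`**),
  ★★ `natCard_selmer_mul_kerG_zero_eq_seed`, ★★ `natCard_selmerInvariants_zero_eq_seed` (**`#Sel_{2^∞}(W/ℚ_∞)^Γ = 2^{𝔢}`**, `𝔢 = ord₂ Tam + 2·ord₂ #W̃(𝔽₂) + s`).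
Reading for C2 / K4: every theorem of the lineage displaying `hnf : ∀ N finite, N = ⊥` (gens 54–59: exact layer products, exact doors, `#(X/Ψ_nX) = #Λ/(f_X,Ψ_n)`) is now hypothesis-free on
the seed cell; the K4 doors' print binder `h414` is discharged per seed curve in the shape they consume. Nothing numerical is asserted about any curve; C2 untouched.
Memo `Cruxes/MainConjectureOfRankZeroBSDAtTwo/EULER-BRIDGE-att-p5-g61.md`.

References: R. Greenberg, LNM 1716 (1999), §3 Lemmas 3.3–3.5, §4 Thm. 4.1, Lemmas 4.2–4.3, Prop. 4.14–4.15 (pp. 124–125) [GreenbergLNM1716]; Y. Hachimori, K. Matsuno, Proc. AMS 128 (2000)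
Cor. (i) [HachimoriMatsuno2000]; L. Washington, GTM 83, §13.2 (Nakayama) [Washington1997].
-/

set_option linter.dupNamespace false
set_option autoImplicit false

noncomputable section

open scoped Classical Polynomial

universe u

namespace Summit.BirchSwinnertonDyer.BirchSwinnertonDyer.Theorems.AlignedTransportAtTwoHalfDescentBaseIndexNoFinite

open NumberField IsDedekindDomain WeierstrassCurve Literature.NumberTheory.EllipticCurves Literature.NumberTheory.EllipticCurves.IwasawaAlgebra
  Literature.NumberTheory.EllipticCurves.Rank1Residual
  Summit.BirchSwinnertonDyer.Rank1Residual.X1.MuLambda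
  Summit.BirchSwinnertonDyer.Rank1Residual.X1.GeneratorBoundMu
  Summit.BirchSwinnertonDyer.Rank1Residual.Iwasawa
  Summit.BirchSwinnertonDyer.BirchSwinnertonDyer.Theorems
  Summit.BirchSwinnertonDyer.BirchSwinnertonDyer.Theorems.AlignedTransportAtTwoHalfDescentBaseIndexSelmer
  Summit.BirchSwinnertonDyer.BirchSwinnertonDyer.Theorems.AlignedTransportAtTwoHalfDescentLayerIndexGrowthFiniteCell
  Summit.BirchSwinnertonDyer.BirchSwinnertonDyer.Theorems.AlignedTransportAtTwoHalfDescentBaseIndexEuler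
  Summit.BirchSwinnertonDyer.BirchSwinnertonDyer.Theorems.AlignedTransportAtTwoHalfDescentBaseIndexTamagawa

/-! ## §1 Nakayama for a finite submodule with trivial `T`-coinvariants; a finite set of places -/

section Algebra

variable {p : ℕ} [hp : Fact p.Prime] {M : Type u} [AddCommGroup M] [Module (IwasawaAlgebra p) M]

/-- ★ **A finite `Λ`-submodule `F` with `#(F/TF) = 1` is `0`.** `F/TF` is a singleton, so `TF = F`; `F` is finitely generated and `T` lies in the maximal ideal
`𝔪_Λ = (p, T)` of the local ring `Λ`, hence in the Jacobson radical: Nakayama. [cite: Washington1997, §13.2 (Nakayama's lemma)] -/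
theorem submodule_eq_bot_of_natCard_quotient_X_smul_top_eq_one (F : Submodule (IwasawaAlgebra p) M) [Finite F]
    (h1 : Nat.card (F ⧸ (Ideal.span {(PowerSeries.X : IwasawaAlgebra p)} • ⊤ : Submodule (IwasawaAlgebra p) F)) = 1) : F = ⊥ := by
  -- `TF = F`
  have hsub : Subsingleton (F ⧸ (Ideal.span {(PowerSeries.X : IwasawaAlgebra p)} • ⊤ : Submodule (IwasawaAlgebra p) F)) :=
    (Nat.card_eq_one_iff_unique.mp h1).1
  have htop : (Ideal.span {(PowerSeries.X : IwasawaAlgebra p)} • ⊤ : Submodule (IwasawaAlgebra p) F) = ⊤ :=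
    Submodule.Quotient.subsingleton_iff.mp hsub
  -- Nakayama in the local ring `Λ`
  haveI : Module.Finite (IwasawaAlgebra p) F := inferInstance
  have hX : (PowerSeries.X : IwasawaAlgebra p) ∈ IsLocalRing.maximalIdeal (IwasawaAlgebra p) := by
    rw [IsLocalRing.mem_maximalIdeal, mem_nonunits_iff, PowerSeries.isUnit_iff_constantCoeff]
    simp
  have hjac : Ideal.span {(PowerSeries.X : IwasawaAlgebra p)} ≤ (⊥ : Ideal (IwasawaAlgebra p)).jacobson :=
    ((Ideal.span_singleton_le_iff_mem _).mpr hX).trans (IsLocalRing.maximalIdeal_le_jacobson _)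
  have htop' : (⊤ : Submodule (IwasawaAlgebra p) F) = ⊥ :=
    Submodule.eq_bot_of_le_smul_of_le_jacobson_bot (Ideal.span {(PowerSeries.X : IwasawaAlgebra p)}) ⊤ Module.Finite.fg_top (le_of_eq htop.symm) hjac
  -- `F` is trivial
  rw [eq_bot_iff]
  intro x hx
  have hmem : (⟨x, hx⟩ : F) ∈ (⊥ : Submodule (IwasawaAlgebra p) F) := htop' ▸ Submodule.mem_top
  rw [Submodule.mem_bot] at hmem ⊢
  exact congrArg Subtype.val hmem

/-- ★ For an elliptic curve over a number field `K` and a prime `p` there is a finite set `S` of finite places containing every place above `p` and every place of bad reduction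
(tree `WeierstrassCurve.finite_badPlaces_holds`, and finiteness of the places above `p`). [cite: SilvermanAEC2009, VIII.1 Remark 1.3] -/
theorem exists_finset_places {K : Type u} [Field K] [NumberField K] (W : WeierstrassCurve K) [W.IsElliptic] :
    ∃ S : Finset (HeightOneSpectrum (𝓞 K)), ∀ v : HeightOneSpectrum (𝓞 K), (p : 𝓞 K) ∈ v.asIdeal ∨ ¬ W.HasGoodReductionAt v → v ∈ S := by
  have hSfin : ({v : HeightOneSpectrum (𝓞 K) | (p : 𝓞 K) ∈ v.asIdeal} ∪ W.badPlaces (𝓞 K)).Finite := by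
    refine Set.Finite.union ?_ (W.finite_badPlaces_holds (𝓞 K))
    have hne : Ideal.span {(p : 𝓞 K)} ≠ 0 := by
      rw [Ideal.zero_eq_bot, Ne, Ideal.span_singleton_eq_bot]
      exact_mod_cast hp.out.ne_zero
    refine (Ideal.finite_factors hne).subset fun v hv ↦ ?_
    simp only [Set.mem_setOf_eq] at hv ⊢
    exact Ideal.dvd_iff_le.mpr ((Ideal.span_singleton_le_iff_mem _).mpr hv)
  refine ⟨hSfin.toFinset, fun v hv ↦ ?_⟩
  rw [Set.Finite.mem_toFinset, Set.mem_union]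
  rcases hv with h | h
  · exact Or.inl h
  · exact Or.inr h

end Algebra

/-! ## §2 The squeeze over `ℚ` at a good ordinary `p` with PURE `p`-power point count mod `p` -/

section Rat

variable (W : WeierstrassCurve ℚ) [W.IsElliptic] [W.IsGloballyMinimal] {p : ℕ} [hp : Fact p.Prime] (κ : ZpExtension ℚ p) {γ : Field.absoluteGaloisGroup ℚ}

/-- ★★★ **THE SQUEEZE: `#(F/TF) = 1` for every finite `F ≤ X(W/ℚ_∞)` with `X/F` free of finite submodules** — `W/ℚ` globally minimal, good ORDINARY at `p`, `W(ℚ)[p] = 0`, `#W̃(𝔽_p) = p^k` a PURE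
power of `p`, `κ` cyclotomic with generator `γ`, ANY dual datum, `#Sel_{p^∞}(W/ℚ) = p^s`. (`p^{v+2k+s}·#(F/TF) = #Sel·#ker g_0 ≤ p^s·p^k·p^k·p^v`.)
[cite: GreenbergLNM1716, §3 Lemmas 3.3–3.5, §4 Thm. 4.1, Lemmas 4.2–4.3, Prop. 4.14] -/
theorem natCard_quotient_eq_one_of_pure (hgo : GoodOrd W p) (hκ : κ.IsCyclotomic) (hγ : κ.IsTopGenerator γ) (hK : ∀ P : W.toAffine.Point, p • P = 0 → P = 0)
    {k : ℕ} (hN : W.reductionPointCount p = p ^ k) (D : W.SelmerDualData κ γ) [hSel : Finite (W.selmerGroupPInfty p)] {s : ℕ} (hs : Nat.card (W.selmerGroupPInfty p) = p ^ s)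
    (F : Submodule (IwasawaAlgebra p) D.X) [Finite F] (hF : ∀ N : Submodule (IwasawaAlgebra p) (D.X ⧸ F), Finite N → N = ⊥) :
    Nat.card (F ⧸ (Ideal.span {(PowerSeries.X : IwasawaAlgebra p)} • ⊤ : Submodule (IwasawaAlgebra p) F)) = 1 := by
  obtain ⟨S, hS⟩ := exists_finset_places (p := p) W
  -- the Euler side
  have hE := natCard_selmer_mul_kerG_zero_eq_cell W κ hgo hκ hγ hK D F hF
  -- the local side
  obtain ⟨-, hle⟩ := natCard_kerG_zero_le_explicit_rat W κ hgo hκ S hS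
  have hcount : Nat.card ((integralModelInt W).map (Int.castRingHom (ZMod p))).toAffine.Point = W.reductionPointCount p := rfl
  rw [natCard_primaryComponent_eq_pow_padicValNat p, hcount, hN, hs] at hE
  simp only [padicValNat.prime_pow] at hE
  rw [hN, padicValNat.prime_pow] at hle
  haveI : Finite (F ⧸ (Ideal.span {(PowerSeries.X : IwasawaAlgebra p)} • ⊤ : Submodule (IwasawaAlgebra p) F)) := Finite.of_surjective _ (Submodule.mkQ_surjective _)
  have hpos : 0 < Nat.card (F ⧸ (Ideal.span {(PowerSeries.X : IwasawaAlgebra p)} • ⊤ : Submodule (IwasawaAlgebra p) F)) := Nat.card_pos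
  -- squeeze: `p^{v+2k+s}·c = p^s·#ker g_0 ≤ p^s·(p^k·p^k·p^v)`
  have h1 : p ^ (padicValNat p W.tamagawaProduct + 2 * k + s) * Nat.card (F ⧸ (Ideal.span {(PowerSeries.X : IwasawaAlgebra p)} • ⊤ : Submodule (IwasawaAlgebra p) F)) ≤
      p ^ s * (p ^ k * p ^ k * p ^ padicValNat p W.tamagawaProduct) := by
    rw [← hE]; exact Nat.mul_le_mul_left _ hle
  have h2 : p ^ s * (p ^ k * p ^ k * p ^ padicValNat p W.tamagawaProduct) = p ^ (padicValNat p W.tamagawaProduct + 2 * k + s) * 1 := by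
    rw [mul_one, ← pow_add, ← pow_add, ← pow_add]; congr 1; ring
  rw [h2] at h1
  have h3 := Nat.le_of_mul_le_mul_left h1 (pow_pos hp.out.pos _)
  omega

/-- ★★★ **NO FINITE SUBMODULE: every finite `Λ`-submodule of `X(W/ℚ_∞)` is `0`** — `W/ℚ` globally minimal, good ORDINARY at `p` with `#W̃(𝔽_p) = p^k` (pure), `W(ℚ)[p] = 0`, `κ` cyclotomic with
generator `γ`, ANY dual datum, `#Sel_{p^∞}(W/ℚ) = p^s`. Greenberg's Prop. 4.14 / Hachimori–Matsuno Cor. (i) on this locus, by the squeeze and Nakayama.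
[cite: GreenbergLNM1716, Prop. 4.14–4.15 (pp. 124–125)] [cite: HachimoriMatsuno2000, Corollary (i)] -/
theorem forall_finite_submodule_eq_bot_of_pure (hgo : GoodOrd W p) (hκ : κ.IsCyclotomic) (hγ : κ.IsTopGenerator γ) (hK : ∀ P : W.toAffine.Point, p • P = 0 → P = 0)
    {k : ℕ} (hN : W.reductionPointCount p = p ^ k) (D : W.SelmerDualData κ γ) [hSel : Finite (W.selmerGroupPInfty p)] {s : ℕ} (hs : Nat.card (W.selmerGroupPInfty p) = p ^ s) :
    ∀ N : Submodule (IwasawaAlgebra p) D.X, Finite N → N = ⊥ := by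
  haveI : Module.Finite (IwasawaAlgebra p) D.X := D.module_finite_holds hγ
  haveI : IsNoetherian (IwasawaAlgebra p) D.X := inferInstance
  obtain ⟨F, hFfin, hFmax⟩ := exists_finite_submodule_forall_finite_le (R := IwasawaAlgebra p) (M := D.X)
  haveI : Finite F := hFfin
  have hF := forall_finite_eq_bot_quotient_of_forall_finite_le F hFmax
  have hFbot : F = ⊥ := submodule_eq_bot_of_natCard_quotient_X_smul_top_eq_one F (natCard_quotient_eq_one_of_pure W κ hgo hκ hγ hK hN D hs F hF)
  intro N hN'
  exact le_bot_iff.mp (hFbot ▸ hFmax N hN')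

/-- ★★ **`#Sel_{p^∞}(W/ℚ)·#ker g_0 = p^{v + 2k + s}`** (hypotheses of `forall_finite_submodule_eq_bot_of_pure`): the honest base number of the `γ`-free door, EXACT.
[cite: GreenbergLNM1716, §4 Thm. 4.1, Lemmas 4.2–4.3] -/
theorem natCard_selmer_mul_kerG_zero_eq_pow_of_pure (hgo : GoodOrd W p) (hκ : κ.IsCyclotomic) (hγ : κ.IsTopGenerator γ) (hK : ∀ P : W.toAffine.Point, p • P = 0 → P = 0)
    {k : ℕ} (hN : W.reductionPointCount p = p ^ k) (D : W.SelmerDualData κ γ) [hSel : Finite (W.selmerGroupPInfty p)] {s : ℕ} (hs : Nat.card (W.selmerGroupPInfty p) = p ^ s) :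
    Nat.card (W.selmerGroupPInfty p) * Nat.card (W.KerG κ 0) = p ^ (padicValNat p W.tamagawaProduct + 2 * k + s) := by
  haveI : Module.Finite (IwasawaAlgebra p) D.X := D.module_finite_holds hγ
  haveI : IsNoetherian (IwasawaAlgebra p) D.X := inferInstance
  obtain ⟨F, hFfin, hFmax⟩ := exists_finite_submodule_forall_finite_le (R := IwasawaAlgebra p) (M := D.X)
  haveI : Finite F := hFfin
  have hF := forall_finite_eq_bot_quotient_of_forall_finite_le F hFmax
  have hE := natCard_selmer_mul_kerG_zero_eq_cell W κ hgo hκ hγ hK D F hF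
  have h1 := natCard_quotient_eq_one_of_pure W κ hgo hκ hγ hK hN D hs F hF
  have hcount : Nat.card ((integralModelInt W).map (Int.castRingHom (ZMod p))).toAffine.Point = W.reductionPointCount p := rfl
  rw [h1, mul_one, natCard_primaryComponent_eq_pow_padicValNat p, hcount, hN, hs] at hE
  simp only [padicValNat.prime_pow] at hE
  rw [hs, hE]

/-- ★★ **`#ker g_0 = p^{v + 2k}` EXACTLY** (hypotheses of `forall_finite_submodule_eq_bot_of_pure`): Greenberg's control kernel at the base equals the product of the local kernel bounds —
every local kernel is saturated and the localisation map is numerically onto. [cite: GreenbergLNM1716, §3 Lemmas 3.3–3.5, §4 Thm. 4.1] -/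
theorem natCard_kerG_zero_eq_pow_of_pure (hgo : GoodOrd W p) (hκ : κ.IsCyclotomic) (hγ : κ.IsTopGenerator γ) (hK : ∀ P : W.toAffine.Point, p • P = 0 → P = 0)
    {k : ℕ} (hN : W.reductionPointCount p = p ^ k) (D : W.SelmerDualData κ γ) [hSel : Finite (W.selmerGroupPInfty p)] {s : ℕ} (hs : Nat.card (W.selmerGroupPInfty p) = p ^ s) :
    Nat.card (W.KerG κ 0) = p ^ (padicValNat p W.tamagawaProduct + 2 * k) := by
  have h := natCard_selmer_mul_kerG_zero_eq_pow_of_pure W κ hgo hκ hγ hK hN D hs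
  rw [hs, show padicValNat p W.tamagawaProduct + 2 * k + s = s + (padicValNat p W.tamagawaProduct + 2 * k) by ring, pow_add] at h
  exact Nat.eq_of_mul_eq_mul_left (pow_pos hp.out.pos _) h

/-- ★★ **`#Sel_{p^∞}(W/ℚ_∞)^Γ = p^{v + 2k + s}` EXACTLY** (hypotheses of `forall_finite_submodule_eq_bot_of_pure`): the base term of the lineage on this locus has no finite-part factor.
[cite: GreenbergLNM1716, §4 Thm. 4.1, Lemma 4.2] -/
theorem natCard_selmerInvariants_zero_eq_pow_of_pure (hgo : GoodOrd W p) (hκ : κ.IsCyclotomic) (hγ : κ.IsTopGenerator γ) (hK : ∀ P : W.toAffine.Point, p • P = 0 → P = 0)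
    {k : ℕ} (hN : W.reductionPointCount p = p ^ k) (D : W.SelmerDualData κ γ) [hSel : Finite (W.selmerGroupPInfty p)] {s : ℕ} (hs : Nat.card (W.selmerGroupPInfty p) = p ^ s) :
    Nat.card ↥(W.selmerInfty κ ⊓ W.layerInvariants κ 0) = p ^ (padicValNat p W.tamagawaProduct + 2 * k + s) := by
  have h43 := W.natCard_selmerInvariants_mul_natCard_ker_layerToInfty κ 0
  have hh : Nat.card (W.layerToInfty κ 0).ker = 1 := natCard_ker_layerToInfty_eq_one W κ (fun P hP ↦ hK P (by convert hP using 10)) 0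
  rw [hh, mul_one, W.natCard_selmerLayer_zero_eq κ, natCard_selmer_mul_kerG_zero_eq_pow_of_pure W κ hgo hκ hγ hK hN D hs] at h43
  exact h43

end Rat

/-! ## §3 `p = 2`: the seed cell of C2 -/

section Two

variable (W : WeierstrassCurve ℚ) [W.IsElliptic] [W.IsGloballyMinimal] (κ₂ : ZpExtension ℚ 2) {γ : Field.absoluteGaloisGroup ℚ}

/-- ★★★ **NO FINITE SUBMODULE ON THE SEED CELL: for every `W/ℚ` (globally minimal) with good ORDINARY reduction at `2` and no rational `2`-torsion abscissa, the cyclotomic `ℤ₂`-extension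
with generator `γ`, EVERY Pontryagin-dual datum `D` and `#Sel_{2^∞}(W/ℚ) = 2^s` finite: every finite `Λ`-submodule of `X(W/ℚ_∞)` is `0`.** Greenberg's Prop. 4.14 (named fact
`Greenberg1999.prop414_noFiniteSubmodule_of_not_dvd_torsionOrder`) at `p = 2` on the rank-`0` good-ordinary locus — a THEOREM, by the numerical squeeze (`#W̃(𝔽₂) ∈ {2,4}` is a pure power of `2`).
[cite: GreenbergLNM1716, Prop. 4.14–4.15 (pp. 124–125)] [cite: HachimoriMatsuno2000, Corollary (i)] -/
theorem forall_finite_submodule_eq_bot_seed (hgo : GoodOrd W 2) (ht : ∀ x : ℚ, ¬ Greenberg1999.HasRationalTwoTorsionX W x) (hκ : κ₂.IsCyclotomic) (hγ : κ₂.IsTopGenerator γ)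
    (D : W.SelmerDualData κ₂ γ) [hSel : Finite (W.selmerGroupPInfty 2)] {s : ℕ} (hs : Nat.card (W.selmerGroupPInfty 2) = 2 ^ s) :
    ∀ N : Submodule (IwasawaAlgebra 2) D.X, Finite N → N = ⊥ :=
  forall_finite_submodule_eq_bot_of_pure W κ₂ hgo hκ hγ (forall_two_nsmul_eq_zero W ht) (GoodOrdTower.reductionPointCount_two_eq_pow W hgo) D hs

/-- ★★ **`#Sel_{2^∞}(W/ℚ)·#ker g_0 = 2^{𝔢}`, `𝔢 = ord₂ Tam(W) + 2·ord₂ #W̃(𝔽₂) + s`** on the seed cell (hypotheses of `forall_finite_submodule_eq_bot_seed`).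
[cite: GreenbergLNM1716, §4 Thm. 4.1, Lemmas 4.2–4.3] -/
theorem natCard_selmer_mul_kerG_zero_eq_seed (hgo : GoodOrd W 2) (ht : ∀ x : ℚ, ¬ Greenberg1999.HasRationalTwoTorsionX W x) (hκ : κ₂.IsCyclotomic) (hγ : κ₂.IsTopGenerator γ)
    (D : W.SelmerDualData κ₂ γ) [hSel : Finite (W.selmerGroupPInfty 2)] {s : ℕ} (hs : Nat.card (W.selmerGroupPInfty 2) = 2 ^ s) :
    Nat.card (W.selmerGroupPInfty 2) * Nat.card (W.KerG κ₂ 0) = 2 ^ (padicValNat 2 W.tamagawaProduct + 2 * padicValNat 2 (W.reductionPointCount 2) + s) :=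
  natCard_selmer_mul_kerG_zero_eq_pow_of_pure W κ₂ hgo hκ hγ (forall_two_nsmul_eq_zero W ht) (GoodOrdTower.reductionPointCount_two_eq_pow W hgo) D hs

/-- ★★ **`#ker g_0(W) = 2^{ord₂ Tam(W) + 2·ord₂ #W̃(𝔽₂)}` EXACTLY on the seed cell** (hypotheses of `forall_finite_submodule_eq_bot_seed`; independent of `s` and of the datum).
[cite: GreenbergLNM1716, §3 Lemmas 3.3–3.5, §4 Thm. 4.1] -/
theorem natCard_kerG_zero_eq_seed (hgo : GoodOrd W 2) (ht : ∀ x : ℚ, ¬ Greenberg1999.HasRationalTwoTorsionX W x) (hκ : κ₂.IsCyclotomic) (hγ : κ₂.IsTopGenerator γ)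
    (D : W.SelmerDualData κ₂ γ) [hSel : Finite (W.selmerGroupPInfty 2)] {s : ℕ} (hs : Nat.card (W.selmerGroupPInfty 2) = 2 ^ s) :
    Nat.card (W.KerG κ₂ 0) = 2 ^ (padicValNat 2 W.tamagawaProduct + 2 * padicValNat 2 (W.reductionPointCount 2)) :=
  natCard_kerG_zero_eq_pow_of_pure W κ₂ hgo hκ hγ (forall_two_nsmul_eq_zero W ht) (GoodOrdTower.reductionPointCount_two_eq_pow W hgo) D hs

/-- ★★ **`#Sel_{2^∞}(W/ℚ_∞)^Γ = 2^{𝔢}` EXACTLY on the seed cell** (hypotheses of `forall_finite_submodule_eq_bot_seed`) — the base term of the whole lineage for a seed, with no finite part.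
[cite: GreenbergLNM1716, §4 Thm. 4.1, Lemma 4.2] -/
theorem natCard_selmerInvariants_zero_eq_seed (hgo : GoodOrd W 2) (ht : ∀ x : ℚ, ¬ Greenberg1999.HasRationalTwoTorsionX W x) (hκ : κ₂.IsCyclotomic) (hγ : κ₂.IsTopGenerator γ)
    (D : W.SelmerDualData κ₂ γ) [hSel : Finite (W.selmerGroupPInfty 2)] {s : ℕ} (hs : Nat.card (W.selmerGroupPInfty 2) = 2 ^ s) :
    Nat.card ↥(W.selmerInfty κ₂ ⊓ W.layerInvariants κ₂ 0) = 2 ^ (padicValNat 2 W.tamagawaProduct + 2 * padicValNat 2 (W.reductionPointCount 2) + s) :=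
  natCard_selmerInvariants_zero_eq_pow_of_pure W κ₂ hgo hκ hγ (forall_two_nsmul_eq_zero W ht) (GoodOrdTower.reductionPointCount_two_eq_pow W hgo) D hs

end Two

end Summit.BirchSwinnertonDyer.BirchSwinnertonDyer.Theorems.AlignedTransportAtTwoHalfDescentBaseIndexNoFinite

end
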